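import Literature.NumberTheory.Rogawski1990.RankOneUnstableWildLawTorusPrelude    -- ★ p844590 F0P3-p01 (g15): frame at `w` (all `t`), Eisenstein side conditions, `exists_wildLaw_torus_of_shellLaws_of_nonneg` (brings ★ fold p844308, ★ renormalise p844316)
import Literature.NumberTheory.Rogawski1990.RankOneKappaOrbitalShellDressTorus      -- ★ p844241∕p844255∕p844317 A-p13 (g32) (B6-H): `exists_bound_integral_conj_sub_eq_sum_shells_of_forall_descent`
import Literature.NumberTheory.Rogawski1990.RankOneUnstableWildWindowConstancy      -- ★ p844135 B-p04 (g35) (B6-W): `wildWindow_eventually_eq`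
import Literature.NumberTheory.Rogawski1990.RankOneUnstableWildTorusWrapper         -- ★ p844450 + p844466 B-p12 (g30) (B6-O): `exists_depth_sign_dictionary_torus_of_symbol`, `descent_scalars_ne_zero`
import Literature.NumberTheory.Rogawski1990.RankOneUnstableWildValueLaws            -- ☐→★ F0P3a-p08 (g16) + B-p14 (g34) (B6-V): `exists_wildValueLaws` (the value laws on the torus)
import HarnessLib

/-!
# (W′-B6) «THE WILD LAW ON THE TORUS» — THE CLOSE `exists_wildLaw_torus`
# (road «R1LL-WILD» = W′ of «R1LL-tree»; Labesse–Langlands 1979 §2 (2.1)–(2.2); Labesse 2024 Th. 0.0.12; Rogawski 1990 §4.9 Lemma 4.9.3; architect A-p16 RULINGS A-43∕A-44∕A-48′)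

Topic `NumberTheory/Rogawski1990`; namespace `Literature.NumberTheory.Rogawski1990`.  ONE THEOREM (no definition, no instance, no notation, no named fact, no `sorry`);
kernel lane `--supports stmt-HodgeConjecture-24833`.  Cell `pub/hodgecm-mathlib` (D-0151), crux H413 = `stmt-HodgeConjecture-24833`; consumer = the W′ END HEAD
`rankOneUnstable_core_ramified_wild` (F0P3a-p03 (g13), binder `hB6`, CERT v4 817236b8 — the statement below is that binder's text VERBATIM), which closes «N6nsGerm»
`stub_N6nsR1ramWild` and with it the residue-free letter (R1) `RankOneUnstableTransferNonsplitCME`.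
HONEST LABEL: HC_CM is proved only modulo the printed citations (2 remaining named inputs hLiu418 24832, h413 24833) until rung 0 closes; this file is the composition of ★
theorems and asserts nothing printed.

THE STATEMENT.  At a ramified non-split `w ∣ v` of the CM extension `L ∕ L⁺`, for the framed elliptic torus `Z(t₀)` of `H_v = U(Φ₂)_v × U(Φ₁)_v` (frame `(t₀, P, d)`), the ★ R-0
partner `e = Ad diag(1, u)` (`u ∈ L_wˣ` a `σ_w`-fixed unit which is NOT a norm), a skew `η`, the difference coordinate `bc : Z(t₀) → (L⁺_v)ˣ` (`ι_w (bc t) = (τ₀ t∕τ₁ t − τ₁ t∕τ₀ t)_w ∕ η`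
above `Nb`), an Eisenstein datum `(α; ϖ_F; K, x₀; u₀, v₀; τ_E; η_E, u_η)` and the per-`t` STANDARD POSITION `hpos` (every `E₂ (↑t).1` descends through `diag(1, α)` to a multiple of an
element of the torus `{(a, b v₀; b, a + b u₀)}`): there are a window bottom `m₀`, a sign `κβ`, a window sum `W` and a depth `oβ` with
(hO) `∫ f(y ↑t y⁻¹) dν − ∫ f(y (e ↑t) y⁻¹) dν = κβ t · q^{oβ t} · W t` for regular `t` with `m₀ ≤ N t`; (hW) `W` eventually constant at every singular `s`;
(hκβ) `κβ t = ((bc t, θ)_v : ℂ)`; (hoβ) `|ι_w (bc t)|_w = exp(−2·oβ t)` — Labesse–Langlands (2.1)–(2.2) ∕ Labesse Th. 0.0.12 at an elliptic torus of `U(Φ₂)_v`.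

THE PROOF = one `obtain` chain over ★ files: (B6-H) ★ A-p13 (g32) `exists_bound_integral_conj_sub_eq_sum_shells_of_forall_descent` (the κ-difference as a sum over the shells of
the tree, all vertices, counts `2·q^m`) → (B6-V) ★ F0P3a-p08 (g16) ∕ B-p14 (g33–g34) `exists_wildValueLaws` (window bottom `mfl`, level `j`, radius `R`, depth `oT`, sign `κT`,
window families `Φ ΦD ∕ Nf NDf` with `hjo hdeep hwin htop`, continuity at the singular points, and the coordinate spec of `oT ∕ κT`) → (B6-O) ★ B-p12 (g30)
`exists_depth_sign_dictionary_torus_of_symbol` (the depth∕sign dictionary against `bc`: `hoT hκT hnn` above `M`; its side conditions `v₀ ≠ 0`, `τ_E ≠ σ_w τ_E` and the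
`t₀`-form of the standard position with `b ≠ 0` are derived here from `hv1 hϖF hτ hστ`, `hpos ⟨t₀, _⟩` and `ht₀` — ★ Prelude §1–§2, ★ `descent_scalars_ne_zero`,
★ `frame_onePlace_of_mem_centralizer_of_v_eq`) → (B6-W) ★ B-p04 (g35) `wildWindow_eventually_eq` → ★ Prelude §3 `exists_wildLaw_torus_of_shellLaws_of_nonneg`
(fold ∘ renormalise, `oT` transparent) at the threshold `max mfl M`.

## References
* [LabesseLanglands1979] J.-P. Labesse, R. P. Langlands, *L-indistinguishability for SL(2)*, Canad. J. Math. 31 (1979) 726–785: §2 (2.1)–(2.2), Lemma 2.1 pp. 8–10.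
* [Labesse2024StabilisationGermesSL2] J.-P. Labesse, *Stabilisation des germes de SL(2)* (arXiv:2411.14820, 2024): Prop. 0.0.10–0.0.11, Th. 0.0.12 pp. 7–8.
* [Rogawski1990] J. D. Rogawski, *Automorphic Representations of Unitary Groups in Three Variables*, Ann. of Math. Stud. 123 (1990): §3.6 pp. 31–32; §4.9 Lemma 4.9.3, (4.9.2) pp. 54–56.
-/

set_option autoImplicit false

noncomputable section

open Set Filter Topology MeasureTheory NumberField IsDedekindDomain Finset Matrix ValuativeRel Function MulAction
open scoped Matrix MatrixGroups ValuativeRel WithZero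

namespace Literature.NumberTheory.Rogawski1990

open Literature.NumberTheory.Automorphic Literature.NumberTheory.Automorphic.UnitaryGroup Literature.NumberTheory.GaloisRepresentations
open Literature.NumberTheory.QuadraticForms Literature.NumberTheory.NumberFields Literature.NumberTheory.Automorphic.HermitianLatticeTree





section WildLaw

variable (L : Type) [Field L] [NumberField L] [IsCMField L] (v : HeightOneSpectrum (𝓞 ↥(maximalRealSubfield L)))
  (w : PlacesOver L v) (hw : IsCMField.complexConj L • w.1 = w.1)
  [MeasurableSpace ((cmDatum L 2 (Matrix.of fun i j : Fin 2 => if i.val + j.val + 1 = 2 then (1 : L) else 0)).Local v × (cmDatum L 1 (Matrix.of fun i j : Fin 1 => if i.val + j.val + 1 = 1 then (1 : L) else 0)).Local v)] [BorelSpace ((cmDatum L 2 (Matrix.of fun i j : Fin 2 => if i.val + j.val + 1 = 2 then (1 : L) else 0)).Local v × (cmDatum L 1 (Matrix.of fun i j : Fin 1 => if i.val + j.val + 1 = 1 then (1 : L) else 0)).Local v)] (ν : Measure ((cmDatum L 2 (Matrix.of fun i j : Fin 2 => if i.val + j.val + 1 = 2 then (1 : L) else 0)).Local v × (cmDatum L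 1 (Matrix.of fun i j : Fin 1 => if i.val + j.val + 1 = 1 then (1 : L) else 0)).Local v)) [ν.IsHaarMeasure] [ν.IsMulRightInvariant]
  (f : ((cmDatum L 2 (Matrix.of fun i j : Fin 2 => if i.val + j.val + 1 = 2 then (1 : L) else 0)).Local v × (cmDatum L 1 (Matrix.of fun i j : Fin 1 => if i.val + j.val + 1 = 1 then (1 : L) else 0)).Local v) → ℂ) (hf : IsLocSmooth f)
  (t₀ : ((cmDatum L 2 (Matrix.of fun i j : Fin 2 => if i.val + j.val + 1 = 2 then (1 : L) else 0)).Local v × (cmDatum L 1 (Matrix.of fun i j : Fin 1 => if i.val + j.val + 1 = 1 then (1 : L) else 0)).Local v)) (P : GL (Fin 2) (LocalRing L v)) (d : Fin 2 → LocalRing L v) (ht₀ : IsRegularElt (t₀.1.val : GL (Fin 2) (LocalRing L v)))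
  (hP : (t₀.1.val.val : Matrix (Fin 2) (Fin 2) (LocalRing L v)) * P.val = P.val * Matrix.diagonal d) (hd1 : ∀ i, conjLocal L (IsCMField.complexConj L) v (d i) * d i = 1)

include hw hf ht₀ hP hd1 in
/-- **(W′-B6) THE WILD LAW ON THE TORUS (Labesse–Langlands (2.1)–(2.2) ∕ Labesse 2024 Th. 0.0.12 at an elliptic torus of `U(Φ₂)_v`, ANY ramified `w ∣ v`).**
For the partner `e` of ★ R-0 (`Ad D_u`, `u ∈ L_wˣ` a `σ_w`-fixed unit which is NOT a norm), a skew `η ≠ 0` and the difference coordinate `bc : Z(t₀) → (L⁺_v)ˣ`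
(`ι_w (bc t) = (τ₀ t∕τ₁ t − τ₁ t∕τ₀ t)_w ∕ η` on the regular locus — ★ B-p12 (C1)): there are a window bottom `m₀`, a sign `κβ`, a window sum `W` and a shell depth `oβ` with
(hO) `O(↑t,f) − O(e ↑t,f) = κβ t · q^{oβ t} · W t` for regular `t` with `m₀ ≤ N t`; (hW) `W` eventually constant at every singular `s`; (hκβ) `κβ t = ((bc t, θ)_v : ℂ)`;
(hoβ) `|ι_w (bc t)|_w = exp(−2·oβ t)`.  [cite: LabesseLanglands1979, §2 Lemma 2.1 pp. 8–10] [cite: Labesse2024StabilisationGermesSL2, Prop. 0.0.10, 0.0.11, Th. 0.0.12]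
[cite: Rogawski1990, §4.9 Lemma 4.9.3 p. 56] -/
theorem exists_wildLaw_torus
    (he : v.asIdeal.ramificationIdx' w.1.asIdeal ≠ 1)
    (u : ((w.1.adicCompletion L))ˣ) (hvu : Valued.v (u : (w.1.adicCompletion L)) = 1) (hσu : (galAdicCompletionMap (L := L) (IsCMField.complexConj L) hw) (u : (w.1.adicCompletion L)) = u) (hun : ¬ ∃ z : (w.1.adicCompletion L), (u : (w.1.adicCompletion L)) = (galAdicCompletionMap (L := L) (IsCMField.complexConj L) hw) z * z)
    (E₂ : (cmDatum L 2 (Matrix.of fun i j : Fin 2 => if i.val + j.val + 1 = 2 then (1 : L) else 0)).Local v ≃ₜ* ↥(unitaryGroupOfForm (galAdicCompletionMap (L := L) (IsCMField.complexConj L) hw) (placeForm (Matrix.of fun i j : Fin 2 => if i.val + j.val + 1 = 2 then (1 : L) else 0) w.1))) (hE₂ : ∀ g, ((E₂ g : ↥(unitaryGroupOfForm (galAdicCompletionMap (L := L) (IsCMField.complexConj L) hw) (placeForm (Matrix.of fun i j : Fin 2 => if i.val + j.val + 1 = 2 then (1 : L) else 0) w.1))) : GL (Fin 2) (w.1.adicCompletion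 L)) = ((localNonsplitEquiv (IsCMField.complexConj L) (Matrix.of fun i j : Fin 2 => if i.val + j.val + 1 = 2 then (1 : L) else 0) (IsCMField.complexConj_ne_one L) w hw g : ↥(unitaryGroupOfForm (galAdicCompletionMap (L := L) (IsCMField.complexConj L) hw) (placeForm (Matrix.of fun i j : Fin 2 => if i.val + j.val + 1 = 2 then (1 : L) else 0) w.1))) : GL (Fin 2) (w.1.adicCompletion L)))
    (e : ((cmDatum L 2 (Matrix.of fun i j : Fin 2 => if i.val + j.val + 1 = 2 then (1 : L) else 0)).Local v × (cmDatum L 1 (Matrix.of fun i j : Fin 1 => if i.val + j.val + 1 = 1 then (1 : L) else 0)).Local v) ≃ₜ* ((cmDatum L 2 (Matrix.of fun i j : Fin 2 => if i.val + j.val + 1 = 2 then (1 : L) else 0)).Local v × (cmDatum L 1 (Matrix.of fun i j : Fin 1 => if i.val + j.val + 1 = 1 then (1 : L) else 0)).Local v)) (he2 : ∀ a : ((cmDatum L 2 (Matrix.of fun i j : Fin 2 => if i.val + j.val + 1 = 2 then (1 : L) else 0)).Local v × (cmDatum L 1 (Matrix.of fun i j : Fin 1 => if i.val + j.val + 1 =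 1 then (1 : L) else 0)).Local v), (e a).2 = a.2)
    (hconj : ∀ a : ((cmDatum L 2 (Matrix.of fun i j : Fin 2 => if i.val + j.val + 1 = 2 then (1 : L) else 0)).Local v × (cmDatum L 1 (Matrix.of fun i j : Fin 1 => if i.val + j.val + 1 = 1 then (1 : L) else 0)).Local v), ((E₂ (e a).1 : ↥(unitaryGroupOfForm (galAdicCompletionMap (L := L) (IsCMField.complexConj L) hw) (placeForm (Matrix.of fun i j : Fin 2 => if i.val + j.val + 1 = 2 then (1 : L) else 0) w.1))) : GL (Fin 2) (w.1.adicCompletion L)) = (glDiagonal 2 (w.1.adicCompletion L) ![1, u]) * ((E₂ a.1 : ↥(unitaryGroupOfForm (galAdicCompletionMap (L := L) (IsCMField.complexConj L) hw) (placeForm (Matrix.of fun i j : Fin 2 => if i.val + j.val + 1 = 2 then (1 : L) else 0) w.1))) : GL (Fin 2) (w.1.adicCompletion L)) * ((glDiagonal 2 (w.1.adicCompletion L) ![1, u]))⁻¹)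
    (_hest : ∀ t : ↥(Subgroup.centralizer ({t₀} : Set ((cmDatum L 2 (Matrix.of fun i j : Fin 2 => if i.val + j.val + 1 = 2 then (1 : L) else 0)).Local v × (cmDatum L 1 (Matrix.of fun i j : Fin 1 => if i.val + j.val + 1 = 1 then (1 : L) else 0)).Local v))), IsRegularElt (((t : ((cmDatum L 2 (Matrix.of fun i j : Fin 2 => if i.val + j.val + 1 = 2 then (1 : L) else 0)).Local v × (cmDatum L 1 (Matrix.of fun i j : Fin 1 => if i.val + j.val + 1 = 1 then (1 : L) else 0)).Local v))).1.val : GL (Fin 2) (LocalRing L v)) → IsLocalStablyConjH L v (t : ((cmDatum L 2 (Matrix.of fun i j : Fin 2 => if i.val + j.val + 1 = 2 then (1 : L) else 0)).Local v × (cmDatum L 1 (Matrix.of fun i j : Fin 1 => if i.val + j.val + 1 = 1 then (1 : L) else 0)).Local v)) (e (t : ((cmDatum L 2 (Matrix.of fun i j : Fin 2 => if i.val + j.val + 1 = 2 then (1 : L) else 0)).Local v × (cmDatum L 1 (Matrix.of fun i j : Fin 1 => if i.val + j.val + 1 = 1 then (1 : L) else 0)).Local v))))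
    (η : (w.1.adicCompletion L)) (hση : (galAdicCompletionMap (L := L) (IsCMField.complexConj L) hw) η = -η) (hη0 : η ≠ 0)
    (bc : ↥(Subgroup.centralizer ({t₀} : Set ((cmDatum L 2 (Matrix.of fun i j : Fin 2 => if i.val + j.val + 1 = 2 then (1 : L) else 0)).Local v × (cmDatum L 1 (Matrix.of fun i j : Fin 1 => if i.val + j.val + 1 = 1 then (1 : L) else 0)).Local v))) → (v.adicCompletion ↥(maximalRealSubfield L))ˣ) (Nb : ℕ)
    (hbc : ∀ t : ↥(Subgroup.centralizer ({t₀} : Set ((cmDatum L 2 (Matrix.of fun i j : Fin 2 => if i.val + j.val + 1 = 2 then (1 : L) else 0)).Local v × (cmDatum L 1 (Matrix.of fun i j : Fin 1 => if i.val + j.val + 1 = 1 then (1 : L) else 0)).Local v))), t ∈ {t : ↥(Subgroup.centralizer ({t₀} : Set ((cmDatum L 2 (Matrix.of fun i j : Fin 2 => if i.val + j.val + 1 = 2 then (1 : L) else 0)).Local v × (cmDatum L 1 (Matrix.of fun i j : Fin 1 => if i.val + j.val + 1 = 1 then (1 : L) else 0)).Local v))) | IsRegularElt ((t : ((cmDatum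 L 2 (Matrix.of fun i j : Fin 2 => if i.val + j.val + 1 = 2 then (1 : L) else 0)).Local v × (cmDatum L 1 (Matrix.of fun i j : Fin 1 => if i.val + j.val + 1 = 1 then (1 : L) else 0)).Local v)).1.val : GL (Fin 2) (LocalRing L v))} → Nb ≤ (-WithZero.log (Valued.v ((((P⁻¹).val * ((t : ((cmDatum L 2 (Matrix.of fun i j : Fin 2 => if i.val + j.val + 1 = 2 then (1 : L) else 0)).Local v × (cmDatum L 1 (Matrix.of fun i j : Fin 1 => if i.val + j.val + 1 = 1 then (1 : L) else 0)).Local v)).1.val.val : Matrix (Fin 2) (Fin 2) (LocalRing L v)) * P.val) 0 0 - ((P⁻¹).val * ((t : ((cmDatum L 2 (Matrix.of fun i j : Fin 2 => if i.val + j.val + 1 = 2 then (1 : L) else 0)).Local v × (cmDatum L 1 (Matrix.of fun i j : Fin 1 => if i.val + j.val + 1 = 1 then (1 : L) else 0)).Local v)).1.val.val : Matrix (Fin 2) (Fin 2) (LocalRing L v)) * P.val) 1 1) w))).toNat →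
      toPlace v w ((bc t : (v.adicCompletion ↥(maximalRealSubfield L))ˣ) : v.adicCompletion ↥(maximalRealSubfield L)) =
        ((((P⁻¹).val * ((t : ((cmDatum L 2 (Matrix.of fun i j : Fin 2 => if i.val + j.val + 1 = 2 then (1 : L) else 0)).Local v × (cmDatum L 1 (Matrix.of fun i j : Fin 1 => if i.val + j.val + 1 = 1 then (1 : L) else 0)).Local v)).1.val.val : Matrix (Fin 2) (Fin 2) (LocalRing L v)) * P.val) 0 0) w / (((P⁻¹).val * ((t : ((cmDatum L 2 (Matrix.of fun i j : Fin 2 => if i.val + j.val + 1 = 2 then (1 : L) else 0)).Local v × (cmDatum L 1 (Matrix.of fun i j : Fin 1 => if i.val + j.val + 1 = 1 then (1 : L) else 0)).Local v)).1.val.val : Matrix (Fin 2) (Fin 2) (LocalRing L v)) * P.val) 1 1) w - (((P⁻¹).val * ((t : ((cmDatum L 2 (Matrix.of fun i j : Fin 2 => if i.val + j.val + 1 = 2 then (1 : L) else 0)).Local v × (cmDatum L 1 (Matrix.of fun i j : Fin 1 => if i.val + j.val + 1 = 1 then (1 : L) else 0)).Local v)).1.val.val : Matrix (Fin 2) (Fin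 2) (LocalRing L v)) * P.val) 1 1) w / (((P⁻¹).val * ((t : ((cmDatum L 2 (Matrix.of fun i j : Fin 2 => if i.val + j.val + 1 = 2 then (1 : L) else 0)).Local v × (cmDatum L 1 (Matrix.of fun i j : Fin 1 => if i.val + j.val + 1 = 1 then (1 : L) else 0)).Local v)).1.val.val : Matrix (Fin 2) (Fin 2) (LocalRing L v)) * P.val) 0 0) w) / η)
    -- the tree ∕ Eisenstein block (A-p13 (g32) (B6-H) spelling of record) and STANDARD POSITION
    {α : (w.1.adicCompletion L)} (hα : (galAdicCompletionMap (L := L) (IsCMField.complexConj L) hw) α = -α) (hα0 : α ≠ 0)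
    {ϖF : v.adicCompletion ↥(maximalRealSubfield L)} (hϖF : Valued.v ϖF = WithZero.exp (-1 : ℤ))
    (K : Subgroup ((cmDatum L 2 (Matrix.of fun i j : Fin 2 => if i.val + j.val + 1 = 2 then (1 : L) else 0)).Local v))
    (x₀ : {M : Submodule 𝒪[v.adicCompletion ↥(maximalRealSubfield L)] (Fin 2 → v.adicCompletion ↥(maximalRealSubfield L)) // IsSpecialLattice (RingHom.id _) ϖF !![(0 : v.adicCompletion ↥(maximalRealSubfield L)), 1; -1, 0] M})
    (hx₀ : x₀.1 = latt (1 : Matrix (Fin 2) (Fin 2) (v.adicCompletion ↥(maximalRealSubfield L))))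
    (hK : ∀ g, g ∈ K ↔ rhoVertexActPlace L v w hw hα hα0 hϖF (E₂ g) x₀ = x₀) (hKo : IsOpen ((((K.prod (⊤ : Subgroup ((cmDatum L 1 (Matrix.of fun i j : Fin 1 => if i.val + j.val + 1 = 1 then (1 : L) else 0)).Local v))) : Subgroup ((cmDatum L 2 (Matrix.of fun i j : Fin 2 => if i.val + j.val + 1 = 2 then (1 : L) else 0)).Local v × (cmDatum L 1 (Matrix.of fun i j : Fin 1 => if i.val + j.val + 1 = 1 then (1 : L) else 0)).Local v))) : Set ((cmDatum L 2 (Matrix.of fun i j : Fin 2 => if i.val + j.val + 1 = 2 then (1 : L) else 0)).Local v × (cmDatum L 1 (Matrix.of fun i j : Fin 1 => if i.val + j.val + 1 = 1 then (1 : L) else 0)).Local v)))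
    (hKc : IsCompact ((((K.prod (⊤ : Subgroup ((cmDatum L 1 (Matrix.of fun i j : Fin 1 => if i.val + j.val + 1 = 1 then (1 : L) else 0)).Local v))) : Subgroup ((cmDatum L 2 (Matrix.of fun i j : Fin 2 => if i.val + j.val + 1 = 2 then (1 : L) else 0)).Local v × (cmDatum L 1 (Matrix.of fun i j : Fin 1 => if i.val + j.val + 1 = 1 then (1 : L) else 0)).Local v))) : Set ((cmDatum L 2 (Matrix.of fun i j : Fin 2 => if i.val + j.val + 1 = 2 then (1 : L) else 0)).Local v × (cmDatum L 1 (Matrix.of fun i j : Fin 1 => if i.val + j.val + 1 = 1 then (1 : L) else 0)).Local v)))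
    {u₀ v₀ : v.adicCompletion ↥(maximalRealSubfield L)} (hu : u₀ ∈ 𝒪[v.adicCompletion ↥(maximalRealSubfield L)]) (hu1 : valuation (v.adicCompletion ↥(maximalRealSubfield L)) u₀ < 1)
    (hv1 : valuation (v.adicCompletion ↥(maximalRealSubfield L)) v₀ = valuation (v.adicCompletion ↥(maximalRealSubfield L)) ϖF)
    (hE : ∀ p q : v.adicCompletion ↥(maximalRealSubfield L), valuation (v.adicCompletion ↥(maximalRealSubfield L)) (p ^ 2 + p * q * u₀ - q ^ 2 * v₀) ≤ 1 → p ∈ 𝒪[v.adicCompletion ↥(maximalRealSubfield L)] ∧ q ∈ 𝒪[v.adicCompletion ↥(maximalRealSubfield L)])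
    {τE : (w.1.adicCompletion L)} (hτ : τE * τE = toPlace v w u₀ * τE + toPlace v w v₀) (hστ : (galAdicCompletionMap (L := L) (IsCMField.complexConj L) hw) τE = toPlace v w u₀ - τE)
    (ηE : ((w.1.adicCompletion L))ˣ) (hηE : Valued.v (ηE : (w.1.adicCompletion L)) = WithZero.exp (-1 : ℤ))
    (uη : ↥(unitaryGroupOfForm (galAdicCompletionMap (L := L) (IsCMField.complexConj L) hw) (placeForm (Matrix.of fun i j : Fin 2 => if i.val + j.val + 1 = 2 then (1 : L) else 0) w.1))) (huη : (((uη : ↥(unitaryGroupOfForm (galAdicCompletionMap (L := L) (IsCMField.complexConj L) hw) (placeForm (Matrix.of fun i j : Fin 2 => if i.val + j.val + 1 = 2 then (1 : L) else 0) w.1))) : GL (Fin 2) (w.1.adicCompletion L)) : Matrix (Fin 2) (Fin 2) (w.1.adicCompletion L)) = Matrix.diagonal ![(ηE : (w.1.adicCompletion L)), ((galAdicCompletionMap (L := L) (IsCMField.complexConj L) hw) (ηE : (w.1.adicCompletion L)))⁻¹])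
    (hpos : ∀ t : ↥(Subgroup.centralizer ({t₀} : Set ((cmDatum L 2 (Matrix.of fun i j : Fin 2 => if i.val + j.val + 1 = 2 then (1 : L) else 0)).Local v × (cmDatum L 1 (Matrix.of fun i j : Fin 1 => if i.val + j.val + 1 = 1 then (1 : L) else 0)).Local v))), ∃ (s : (w.1.adicCompletion L)) (γ : GL (Fin 2) (v.adicCompletion ↥(maximalRealSubfield L))) (a b : (v.adicCompletion ↥(maximalRealSubfield L))), (γ : Matrix (Fin 2) (Fin 2) (v.adicCompletion ↥(maximalRealSubfield L))) = !![a, b * v₀; b, a + b * u₀] ∧ Matrix.diagonal ![1, α] * (((((E₂ (t : ((cmDatum L 2 (Matrix.of fun i j : Fin 2 => if i.val + j.val + 1 = 2 then (1 : L) else 0)).Local v × (cmDatum L 1 (Matrix.of fun i j : Fin 1 => if i.val + j.val + 1 = 1 then (1 : L) else 0)).Local v)).1) : ↥(unitaryGroupOfForm (galAdicCompletionMap (L := L) (IsCMField.complexConj L) hw) (placeForm (Matrix.of fun i j : Fin 2 => if i.val + j.val + 1 = 2 then (1 : L) else 0) w.1))) : GL (Fin 2) (w.1.adicCompletion L)))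 : Matrix (Fin 2) (Fin 2) (w.1.adicCompletion L)) * Matrix.diagonal ![1, α⁻¹] = s • (γ : Matrix (Fin 2) (Fin 2) (v.adicCompletion ↥(maximalRealSubfield L))).map (toPlace v w)) :
    ∃ (m₀ : ℕ) (κβ W : ↥(Subgroup.centralizer ({t₀} : Set ((cmDatum L 2 (Matrix.of fun i j : Fin 2 => if i.val + j.val + 1 = 2 then (1 : L) else 0)).Local v × (cmDatum L 1 (Matrix.of fun i j : Fin 1 => if i.val + j.val + 1 = 1 then (1 : L) else 0)).Local v))) → ℂ) (oβ : ↥(Subgroup.centralizer ({t₀} : Set ((cmDatum L 2 (Matrix.of fun i j : Fin 2 => if i.val + j.val + 1 = 2 then (1 : L) else 0)).Local v × (cmDatum L 1 (Matrix.of fun i j : Fin 1 => if i.val + j.val + 1 = 1 then (1 : L) else 0)).Local v))) → ℕ),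
      (∀ t : ↥(Subgroup.centralizer ({t₀} : Set ((cmDatum L 2 (Matrix.of fun i j : Fin 2 => if i.val + j.val + 1 = 2 then (1 : L) else 0)).Local v × (cmDatum L 1 (Matrix.of fun i j : Fin 1 => if i.val + j.val + 1 = 1 then (1 : L) else 0)).Local v))), t ∈ {t : ↥(Subgroup.centralizer ({t₀} : Set ((cmDatum L 2 (Matrix.of fun i j : Fin 2 => if i.val + j.val + 1 = 2 then (1 : L) else 0)).Local v × (cmDatum L 1 (Matrix.of fun i j : Fin 1 => if i.val + j.val + 1 = 1 then (1 : L) else 0)).Local v))) | IsRegularElt ((t : ((cmDatum L 2 (Matrix.of fun i j : Fin 2 => if i.val + j.val + 1 = 2 then (1 : L) else 0)).Local v × (cmDatum L 1 (Matrix.of fun i j : Fin 1 => if i.val + j.val + 1 = 1 then (1 : L) else 0)).Local v)).1.val : GL (Fin 2) (LocalRing L v))} → m₀ ≤ (-WithZero.log (Valued.v ((((P⁻¹).val * ((t : ((cmDatum L 2 (Matrix.of fun i j : Fin 2 => if i.val + j.val + 1 = 2 then (1 : L) else 0)).Local v × (cmDatum L 1 (Matrix.of fun i j : Fin 1 =>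 if i.val + j.val + 1 = 1 then (1 : L) else 0)).Local v)).1.val.val : Matrix (Fin 2) (Fin 2) (LocalRing L v)) * P.val) 0 0 - ((P⁻¹).val * ((t : ((cmDatum L 2 (Matrix.of fun i j : Fin 2 => if i.val + j.val + 1 = 2 then (1 : L) else 0)).Local v × (cmDatum L 1 (Matrix.of fun i j : Fin 1 => if i.val + j.val + 1 = 1 then (1 : L) else 0)).Local v)).1.val.val : Matrix (Fin 2) (Fin 2) (LocalRing L v)) * P.val) 1 1) w))).toNat →
        ((∫ y, f (y * (t : ((cmDatum L 2 (Matrix.of fun i j : Fin 2 => if i.val + j.val + 1 = 2 then (1 : L) else 0)).Local v × (cmDatum L 1 (Matrix.of fun i j : Fin 1 => if i.val + j.val + 1 = 1 then (1 : L) else 0)).Local v)) * y⁻¹) ∂ν) - ∫ y, f (y * e (t : ((cmDatum L 2 (Matrix.of fun i j : Fin 2 => if i.val + j.val + 1 = 2 then (1 : L) else 0)).Local v × (cmDatum L 1 (Matrix.of fun i j : Fin 1 => if i.val + j.val + 1 = 1 then (1 : L) else 0)).Local v)) * y⁻¹) ∂ν) = κβ t * ((Nat.card (𝓞 ↥(maximalRealSubfield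 L) ⧸ v.asIdeal)) : ℂ) ^ (oβ t) * W t) ∧
      (∀ s : ↥(Subgroup.centralizer ({t₀} : Set ((cmDatum L 2 (Matrix.of fun i j : Fin 2 => if i.val + j.val + 1 = 2 then (1 : L) else 0)).Local v × (cmDatum L 1 (Matrix.of fun i j : Fin 1 => if i.val + j.val + 1 = 1 then (1 : L) else 0)).Local v))), ¬ IsRegularElt ((s : ((cmDatum L 2 (Matrix.of fun i j : Fin 2 => if i.val + j.val + 1 = 2 then (1 : L) else 0)).Local v × (cmDatum L 1 (Matrix.of fun i j : Fin 1 => if i.val + j.val + 1 = 1 then (1 : L) else 0)).Local v)).1.val : GL (Fin 2) (LocalRing L v)) →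
        ∀ᶠ (t : ↥(Subgroup.centralizer ({t₀} : Set ((cmDatum L 2 (Matrix.of fun i j : Fin 2 => if i.val + j.val + 1 = 2 then (1 : L) else 0)).Local v × (cmDatum L 1 (Matrix.of fun i j : Fin 1 => if i.val + j.val + 1 = 1 then (1 : L) else 0)).Local v)))) in 𝓝 s, t ∈ {t : ↥(Subgroup.centralizer ({t₀} : Set ((cmDatum L 2 (Matrix.of fun i j : Fin 2 => if i.val + j.val + 1 = 2 then (1 : L) else 0)).Local v × (cmDatum L 1 (Matrix.of fun i j : Fin 1 => if i.val + j.val + 1 = 1 then (1 : L) else 0)).Local v))) | IsRegularElt ((t : ((cmDatum L 2 (Matrix.of fun i j : Fin 2 => if i.val + j.val + 1 = 2 then (1 : L) else 0)).Local v × (cmDatum L 1 (Matrix.of fun i j : Fin 1 => if i.val + j.val + 1 = 1 then (1 : L) else 0)).Local v)).1.val : GL (Fin 2) (LocalRing L v))} → W t = W s) ∧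
      (∀ t : ↥(Subgroup.centralizer ({t₀} : Set ((cmDatum L 2 (Matrix.of fun i j : Fin 2 => if i.val + j.val + 1 = 2 then (1 : L) else 0)).Local v × (cmDatum L 1 (Matrix.of fun i j : Fin 1 => if i.val + j.val + 1 = 1 then (1 : L) else 0)).Local v))), t ∈ {t : ↥(Subgroup.centralizer ({t₀} : Set ((cmDatum L 2 (Matrix.of fun i j : Fin 2 => if i.val + j.val + 1 = 2 then (1 : L) else 0)).Local v × (cmDatum L 1 (Matrix.of fun i j : Fin 1 => if i.val + j.val + 1 = 1 then (1 : L) else 0)).Local v))) | IsRegularElt ((t : ((cmDatum L 2 (Matrix.of fun i j : Fin 2 => if i.val + j.val + 1 = 2 then (1 : L) else 0)).Local v × (cmDatum L 1 (Matrix.of fun i j : Fin 1 => if i.val + j.val + 1 = 1 then (1 : L) else 0)).Local v)).1.val : GL (Fin 2) (LocalRing L v))} → m₀ ≤ (-WithZero.log (Valued.v ((((P⁻¹).val * ((t : ((cmDatum L 2 (Matrix.of fun i j : Fin 2 => if i.val + j.val + 1 = 2 then (1 : L) else 0)).Local v × (cmDatum L 1 (Matrix.of fun i j : Fin 1 =>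 if i.val + j.val + 1 = 1 then (1 : L) else 0)).Local v)).1.val.val : Matrix (Fin 2) (Fin 2) (LocalRing L v)) * P.val) 0 0 - ((P⁻¹).val * ((t : ((cmDatum L 2 (Matrix.of fun i j : Fin 2 => if i.val + j.val + 1 = 2 then (1 : L) else 0)).Local v × (cmDatum L 1 (Matrix.of fun i j : Fin 1 => if i.val + j.val + 1 = 1 then (1 : L) else 0)).Local v)).1.val.val : Matrix (Fin 2) (Fin 2) (LocalRing L v)) * P.val) 1 1) w))).toNat →
        κβ t = ((hilbertSymbol (v.adicCompletion ↥(maximalRealSubfield L)) ((bc t : (v.adicCompletion ↥(maximalRealSubfield L))ˣ) : v.adicCompletion ↥(maximalRealSubfield L))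
          (algebraMap ↥(maximalRealSubfield L) _ ((cmQuadraticGenerator L : 𝓞 ↥(maximalRealSubfield L)) : ↥(maximalRealSubfield L))) : ℤ) : ℂ)) ∧
      (∀ t : ↥(Subgroup.centralizer ({t₀} : Set ((cmDatum L 2 (Matrix.of fun i j : Fin 2 => if i.val + j.val + 1 = 2 then (1 : L) else 0)).Local v × (cmDatum L 1 (Matrix.of fun i j : Fin 1 => if i.val + j.val + 1 = 1 then (1 : L) else 0)).Local v))), t ∈ {t : ↥(Subgroup.centralizer ({t₀} : Set ((cmDatum L 2 (Matrix.of fun i j : Fin 2 => if i.val + j.val + 1 = 2 then (1 : L) else 0)).Local v × (cmDatum L 1 (Matrix.of fun i j : Fin 1 => if i.val + j.val + 1 = 1 then (1 : L) else 0)).Local v))) | IsRegularElt ((t : ((cmDatum L 2 (Matrix.of fun i j : Fin 2 => if i.val + j.val + 1 = 2 then (1 : L) else 0)).Local v × (cmDatum L 1 (Matrix.of fun i j : Fin 1 => if i.val + j.val + 1 = 1 then (1 : L) else 0)).Local v)).1.val : GL (Fin 2) (LocalRing L v))} → m₀ ≤ (-WithZero.log (Valued.v ((((P⁻¹).val * ((t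 : ((cmDatum L 2 (Matrix.of fun i j : Fin 2 => if i.val + j.val + 1 = 2 then (1 : L) else 0)).Local v × (cmDatum L 1 (Matrix.of fun i j : Fin 1 => if i.val + j.val + 1 = 1 then (1 : L) else 0)).Local v)).1.val.val : Matrix (Fin 2) (Fin 2) (LocalRing L v)) * P.val) 0 0 - ((P⁻¹).val * ((t : ((cmDatum L 2 (Matrix.of fun i j : Fin 2 => if i.val + j.val + 1 = 2 then (1 : L) else 0)).Local v × (cmDatum L 1 (Matrix.of fun i j : Fin 1 => if i.val + j.val + 1 = 1 then (1 : L) else 0)).Local v)).1.val.val : Matrix (Fin 2) (Fin 2) (LocalRing L v)) * P.val) 1 1) w))).toNat →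
        Valued.v (toPlace v w ((bc t : (v.adicCompletion ↥(maximalRealSubfield L))ˣ) : v.adicCompletion ↥(maximalRealSubfield L))) = WithZero.exp (-(2 * (oβ t : ℤ)))) := by
  classical
  -- (B6-H) ★ A-p13 ED. 2: the shell unfolding of the κ-difference, keyed on the per-`t` standard position
  obtain ⟨Mb, hShell⟩ := exists_bound_integral_conj_sub_eq_sum_shells_of_forall_descent L v w hw hα hα0 hϖF he ν K E₂ x₀ hx₀ hK hKo f hf t₀ P d ht₀ hP hd1
    u hvu hσu e hconj hu hu1 hv1 hE hτ hστ ηE hηE uη huη hpos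
  -- (B6-O) ★ B-p12 (g30): the depth ∕ sign dictionary along the torus — its side conditions `hv0`, `hτne` and the `t₀`-form of `hpos` (with `b ≠ 0`) derived here
  have hv0 : v₀ ≠ 0 := ne_zero_of_valuation_eq_of_valued_eq_exp L v hϖF hv1
  have hτne : τE ≠ (galAdicCompletionMap (L := L) (IsCMField.complexConj L) hw) τE := ne_galAdicCompletionMap_of_eisenstein L v w hw he hϖF hv1 hτ hστ
  -- (B6-V) ★ F0P3a-p08 (g16) ∕ B-p14 (g34): the value laws on the torus
  obtain ⟨mfl, j, R, oT, κT, Φ, ΦD, Nf, NDf, hjo, hdeep, hwin, htop, hΦ, hΦD, hcont, hspec⟩ :=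
    exists_wildValueLaws L v w hw ν f hf t₀ P d ht₀ hP hd1 he u hvu hσu hun E₂ hE₂ e he2 hconj hα hα0 hϖF K x₀ hx₀ hK hKo hKc hu hu1 hv1 hτ hστ ηE hηE uη huη hpos hτne
  have ht₀mem : t₀ ∈ Subgroup.centralizer ({t₀} : Set ((cmDatum L 2 (Matrix.of fun i j : Fin 2 => if i.val + j.val + 1 = 2 then (1 : L) else 0)).Local v × (cmDatum L 1 (Matrix.of fun i j : Fin 1 => if i.val + j.val + 1 = 1 then (1 : L) else 0)).Local v)) :=
    Subgroup.mem_centralizer_iff.2 fun g hg => by rw [Set.mem_singleton_iff.1 hg]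
  have hpos₀ : ∃ (s : (w.1.adicCompletion L)) (a b : (v.adicCompletion ↥(maximalRealSubfield L))), b ≠ 0 ∧
      Matrix.diagonal ![1, α] * ((((E₂ t₀.1 : ↥(unitaryGroupOfForm (galAdicCompletionMap (L := L) (IsCMField.complexConj L) hw) (placeForm (Matrix.of fun i j : Fin 2 => if i.val + j.val + 1 = 2 then (1 : L) else 0) w.1))) : GL (Fin 2) (w.1.adicCompletion L)) : Matrix (Fin 2) (Fin 2) (w.1.adicCompletion L))) * Matrix.diagonal ![1, α⁻¹] = s • (!![a, b * v₀; b, a + b * u₀]).map (toPlace v w) := by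
    obtain ⟨s, γ, a, b, hγ, hsx⟩ := hpos ⟨t₀, ht₀mem⟩
    rw [hγ] at hsx
    obtain ⟨hX, hinj, hn1, -⟩ := frame_onePlace_of_mem_centralizer_of_v_eq L v w hw t₀ P d ht₀ hP hd1 (ηE : (w.1.adicCompletion L)) hηE E₂ hE₂ ⟨t₀, ht₀mem⟩ ht₀
    have hne := hinj.ne (show (0 : Fin 2) ≠ 1 by decide)
    have hx₁ := right_ne_zero_of_mul_eq_one (hn1 1)
    have hDD : Matrix.diagonal ![(1 : (w.1.adicCompletion L)), α⁻¹] * Matrix.diagonal ![1, α] = 1 := by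
      rw [Matrix.diagonal_mul_diagonal, ← Matrix.diagonal_one]
      congr 1
      ext i; fin_cases i <;> simp [inv_mul_cancel₀ hα0]
    have hQ : IsUnit ((((Matrix.GeneralLinearGroup.map (Pi.evalRingHom (fun w' : PlacesOver L v => w'.1.adicCompletion L) w) P) : GL (Fin 2) (w.1.adicCompletion L)) : Matrix (Fin 2) (Fin 2) (w.1.adicCompletion L))).det :=
      (Matrix.isUnit_iff_isUnit_det _).1 (Units.isUnit _)
    simp only [Matrix.cons_val_zero, Matrix.cons_val_one] at hne hx₁
    exact ⟨s, a, b, (descent_scalars_ne_zero (toPlace v w) hX hDD hsx hQ hne hx₁).2, hsx⟩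
  obtain ⟨M, k₁, c₀, hO⟩ := exists_depth_sign_dictionary_torus_of_symbol L v w hw he t₀ P d ht₀ hP hd1 E₂ hE₂ hα hα0 hv0 hτ hστ hτne hση hη0 hpos₀
    bc Nb hbc mfl oT κT hspec
  -- (B6-W) ★ B-p04: the window sum is eventually constant at the singular points
  have hW := wildWindow_eventually_eq L v ν f hf t₀ K hKc hKo.measurableSet (Nat.card (𝓞 ↥(maximalRealSubfield L) ⧸ v.asIdeal)) j R Nf NDf (fun i hi s hs => (hcont i hi s hs).1) (fun i hi s hs => (hcont i hi s hs).2)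
  -- the fold in the final currency, at the threshold `max mfl M`
  refine exists_wildLaw_torus_of_shellLaws_of_nonneg L v w ν f t₀ P e bc
    (fun m x => ∫ k in (((K).prod (⊤ : Subgroup ((cmDatum L 1 (Matrix.of fun i j : Fin 1 => if i.val + j.val + 1 = 1 then (1 : L) else 0)).Local v)) : Subgroup ((cmDatum L 2 (Matrix.of fun i j : Fin 2 => if i.val + j.val + 1 = 2 then (1 : L) else 0)).Local v × (cmDatum L 1 (Matrix.of fun i j : Fin 1 => if i.val + j.val + 1 = 1 then (1 : L) else 0)).Local v)) : Set ((cmDatum L 2 (Matrix.of fun i j : Fin 2 => if i.val + j.val + 1 = 2 then (1 : L) else 0)).Local v × (cmDatum L 1 (Matrix.of fun i j : Fin 1 => if i.val + j.val + 1 = 1 then (1 : L) else 0)).Local v)), f (k⁻¹ * (((E₂.symm (uη⁻¹ ^ (m)), (1 : (cmDatum L 1 (Matrix.of fun i j : Fin 1 => if i.val + j.val + 1 = 1 then (1 : L) else 0)).Local v)) : ((cmDatum L 2 (Matrix.of fun i j : Fin 2 => if i.val + j.val + 1 = 2 then (1 : L) else 0)).Local v × (cmDatum L 1 (Matrix.of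 fun i j : Fin 1 => if i.val + j.val + 1 = 1 then (1 : L) else 0)).Local v))⁻¹ * x * (E₂.symm (uη⁻¹ ^ (m)), 1)) * k) ∂ν) Mb hShell
    (max mfl M) j R oT κT Φ ΦD
    (fun t ht hm => hjo t ht (le_trans (le_max_left _ _) hm)) (fun t ht hm => hdeep t ht (le_trans (le_max_left _ _) hm))
    (fun t ht hm => hwin t ht (le_trans (le_max_left _ _) hm)) (fun t ht hm => htop t ht (le_trans (le_max_left _ _) hm))
    (fun t => ∑ i ∈ Finset.range (j + R + 1), (2 * ((Nat.card (𝓞 ↥(maximalRealSubfield L) ⧸ v.asIdeal)) : ℂ) ^ i) * (Φ i t - ΦD i t)) (fun _ => rfl) (fun s hs => ?_) k₁ c₀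
    (fun t ht hm => (hO t ht (le_trans (le_max_right _ _) hm)).1) (fun t ht hm => (hO t ht (le_trans (le_max_right _ _) hm)).2.1)
    (fun t ht hm => (hO t ht (le_trans (le_max_right _ _) hm)).2.2)
  -- `hW` in the `Φ ΦD` spelling
  simp only [hΦ, hΦD]
  exact hW s hs

end WildLaw

end Literature.NumberTheory.Rogawski1990

end
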